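import Summits.KontsevichZagierPeriods.KontsevichZagierPeriods.Theses.ScissorsTransport
import Summits.KontsevichZagierPeriods.KontsevichZagierPeriods.Theorems.ScissorsTransportCylinderReduction

/-!
# Route ScissorsTransport — crux `StableSetTransport` (stmt-KontsevichZagierPeriods-2669) SPLIT:
# the Eudoxus–Archimedes decomposition, glued

Crux-strategist decomposition (unit `cstrat-stmt-KontsevichZagierPeriods-2669-r1`, BC2 redirect of the
RESTATED deciding crux = thesis X of the route). Thesis X (`StableSetTransport`: two ℚ-semialgebraic sets of
one dimension with integrand `1` and EQUAL VOLUME are, after `× [0,1]^M` and null removal, source and target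
of ONE rule-(2) move) is assembled from four typed pieces, all written out below over `KZCalculus` /
`KZCalculusProofs` only (they become the children `StableBounding`, `BoundedExhaustion`,
`EmbeddingTransitive`, `StableArchimedes` of the crux in the route file):

* **StableBounding** — every finite-volume ℚ-semialgebraic set (integrand-`1` representation) is stably
  transport-equivalent, in BOTH directions, to a BOUNDED one (monomialisation of the unbounded heights by
  blowings-up and power substitutions with the Jacobian absorbed into the fibre coordinate;
  theorem-type, rectilinearisation of semialgebraic functions).
* **BoundedExhaustion** (Eudoxus) — for bounded integrand-`1` representations with `vol r < vol r'`
  STRICTLY, `r` stably EMBEDS into `r'` by one rule-(2) move (dyadic grid packing: outer Jordan content of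
  `r` against inner Jordan content of `r'`; translations by rational vectors).
* **EmbeddingTransitive** — stable embeddings compose (product stabilisation, restriction to the
  full-measure preimage, chain rule, `|det| = 1 · 1`).
* **StableArchimedes** — if `r × [0,1]²` stably embeds into `(r' × [0,1]²) ⊔ (e × [2,3])` and symmetrically,
  for EVERY slack set `e` one dimension up with non-empty interior, then `r` and `r'` are stably
  transport-equivalent: "stabilised curved scissors congruence has no Dehn invariant" — the piece that
  carries Conjecture 1 (its polytope analogue is false: Dehn–Sydler–Jessen).

`StableSetTransport_of_subs`: equal volumes make the hypothesis of STABLE ARCHIMEDES available through the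
other three pieces — `vol(r × [0,1]²) = vol r = vol r' < vol r' + vol e` (slabs are single Newton–Leibniz
moves and gluing is one domain-additivity move, both SOUND; `vol e > 0` by the interior and integrability),
both ends are replaced by bounded sets of the same value (STABLE BOUNDING + soundness of a stable transport
through `CylinderReduction_proof` and `changeOfVariablesRel ⊆ relations`), BOUNDED EXHAUSTION embeds the
smaller bounded set into the larger, and EMBEDDING TRANSITIVE composes through the forgotten-fullness ends
of the two boundings. Nothing is consumed vacuously: every piece is applied to data produced in the proof.

Sources: M. Kontsevich, D. Zagier, *Periods* (2001), §1.2 (rules (1)–(3), Conjecture 1); J. Cresson,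
J. Viu-Sos, JTNB 34 (2022) §2.1 (Problem 2.1: injectivity of `vol` on `K₀(𝒞SA)`), §4 (polyhedra);
J. Viu-Sos, IJNT 17 (2021) Thm 1.1; E. Bierstone, P. Milman, Publ. IHÉS 67 (1988) §4 (rectilinearisation);
J.-P. Sydler, Comment. Math. Helv. 40 (1965) and J. L. Dupont, *Scissors congruences* (2001) Ch. 1 (the
Dehn invariant: why the polytope analogue of STABLE ARCHIMEDES fails).
Deliberately NOT here: any claim about the four pieces themselves (two are open cruxes, two are
theorem-type supports).
-/

noncomputable section

namespace Summit.KontsevichZagierPeriods.ScissorsTransport.StableSetTransportSplit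

open Set MeasureTheory
open Literature.NumberTheory.Transcendental Literature.NumberTheory.Transcendental.KZ

/-! ### Helper lemmas for the assembly -/

variable {n : ℕ}

/-- The value of a slab is the value of its base (one Newton–Leibniz move; soundness). -/
theorem value_slab' (r : IntegralRep n) (j : ℕ) : (r.slab j).value = r.value :=
  (Equivalent.value_eq_holds (r.equivalent_slab j)).symm

/-- The value of a gluing is the sum of the values (one domain-additivity move; soundness). -/
theorem value_glue' (r₁ r₂ : IntegralRep n) (h : Disjoint r₁.domain r₂.domain) :
    (r₁.glue r₂ h).value = r₁.value + r₂.value := by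
  have h0 := eval_eq_zero_of_mem_domainAddRel_holds (IntegralRep.of_glue_sub_sub_mem_domainAddRel r₁ r₂ h)
  simp only [map_sub, eval_of] at h0
  linarith

/-- A gluing of two integrand-`1` representations has integrand `1`. -/
theorem glue_integrand_eq_one' (r₁ r₂ : IntegralRep n) (h : Disjoint r₁.domain r₂.domain)
    (h₁ : ∀ x ∈ r₁.domain, r₁.integrand x = 1) (h₂ : ∀ x ∈ r₂.domain, r₂.integrand x = 1) :
    ∀ z ∈ (r₁.glue r₂ h).domain, (r₁.glue r₂ h).integrand z = 1 := by
  intro z hz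
  rw [IntegralRep.domain_glue] at hz
  rcases hz with hz | hz
  · rw [IntegralRep.eqOn_integrand_glue_left r₁ r₂ h hz]; exact h₁ z hz
  · rw [IntegralRep.eqOn_integrand_glue_right r₁ r₂ h hz]; exact h₂ z hz

/-- The slab of an integrand-`1` representation has integrand `1`. -/
theorem slab_integrand_eq_one' (r : IntegralRep n) (j : ℕ) (h₁ : ∀ x ∈ r.domain, r.integrand x = 1) :
    ∀ z ∈ (r.slab j).domain, (r.slab j).integrand z = 1 := by
  intro z hz
  simp only [IntegralRep.domain_slab, IntegralRep.slabDomain, mem_setOf_eq] at hz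
  exact h₁ _ hz.1

/-- An integrand-`1` representation whose domain has non-empty interior has positive value. -/
theorem value_pos_of_interior' (e : IntegralRep n) (h₁ : ∀ x ∈ e.domain, e.integrand x = 1)
    (hi : (interior e.domain).Nonempty) : 0 < e.value := by
  rw [IntegralRep.value_eq_volume_real e h₁, measureReal_def]
  have hint : IntegrableOn (fun _ => (1:ℝ)) e.domain :=
    e.integrableOn.congr_fun (fun x hx => h₁ x hx) (IntegralRep.measurableSet_domain_holds e)
  have hfin : volume e.domain < ⊤ := by
    rcases (integrableOn_const_iff).1 hint with h | h
    · simp at h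
    · exact h
  exact ENNReal.toReal_pos (Measure.measure_pos_of_nonempty_interior volume hi).ne' hfin.ne

variable {K : ℕ}

/-- Soundness of a stable transport: the two ends have equal value (cylinder reduction at both
ends, one change-of-variables move in the middle). -/
theorem value_eq_of_transport' (a b : IntegralRep K) (ha : ∀ x ∈ a.domain, a.integrand x = 1)
    (hb : ∀ x ∈ b.domain, b.integrand x = 1)
    (h : ∃ (M : ℕ) (s s' : Literature.NumberTheory.Transcendental.KZ.IntegralRep (K + M)), s.domain ⊆ {z | (fun i : Fin K => z (Fin.castAdd M i)) ∈ a.domain ∧ ∀ j : Fin M, z (Fin.natAdd K j) ∈ Set.Icc (0:ℝ) 1} ∧ MeasureTheory.volume ({z : Fin (K + M) → ℝ | (fun i : Fin K => z (Fin.castAdd M i)) ∈ a.domain ∧ ∀ j : Fin M, z (Fin.natAdd K j) ∈ Set.Icc (0:ℝ) 1} \ s.domain) = 0 ∧ s'.domain ⊆ {z | (fun i : Fin K => z (Fin.castAdd M i)) ∈ b.domain ∧ ∀ j : Fin M, z (Fin.natAdd K j) ∈ Set.Icc (0:ℝ) 1} ∧ MeasureTheory.volume ({z : Fin (K + M) →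 ℝ | (fun i : Fin K => z (Fin.castAdd M i)) ∈ b.domain ∧ ∀ j : Fin M, z (Fin.natAdd K j) ∈ Set.Icc (0:ℝ) 1} \ s'.domain) = 0 ∧ (∀ z ∈ s.domain, s.integrand z = 1) ∧ (∀ z ∈ s'.domain, s'.integrand z = 1) ∧ Literature.NumberTheory.Transcendental.KZ.of s - Literature.NumberTheory.Transcendental.KZ.of s' ∈ Literature.NumberTheory.Transcendental.KZ.changeOfVariablesRel) : a.value = b.value := by
  obtain ⟨M, s, s', hs, hsn, hs', hs'n, hs1, hs'1, hcov⟩ := h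
  have e₁ : Equivalent a s :=
    Summit.KontsevichZagierPeriods.ScissorsTransport.CylinderReduction_proof a s ha hs hsn hs1
  have e₂ : Equivalent b s' :=
    Summit.KontsevichZagierPeriods.ScissorsTransport.CylinderReduction_proof b s' hb hs' hs'n hs'1
  have e₃ : Equivalent s s' := changeOfVariablesRel_subset_relations hcov
  exact Equivalent.value_eq_holds ((e₁.trans e₃).trans e₂.symm)

/-- A stable transport is in particular a stable embedding (forget fullness of the target). -/
theorem embedding_of_transport' (a b : IntegralRep K) (h : ∃ (M : ℕ) (s s' : Literature.NumberTheory.Transcendental.KZ.IntegralRep (K + M)), s.domain ⊆ {z | (fun i : Fin K => z (Fin.castAdd M i)) ∈ a.domain ∧ ∀ j : Fin M, z (Fin.natAdd K j) ∈ Set.Icc (0:ℝ) 1} ∧ MeasureTheory.volume ({z : Fin (K + M) → ℝ | (fun i : Fin K => z (Fin.castAdd M i)) ∈ a.domain ∧ ∀ j : Fin M, z (Fin.natAdd K j) ∈ Set.Icc (0:ℝ) 1} \ s.domain) = 0 ∧ s'.domain ⊆ {z | (fun i : Fin K => z (Fin.castAdd M i)) ∈ b.domain ∧ ∀ j : Fin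 M, z (Fin.natAdd K j) ∈ Set.Icc (0:ℝ) 1} ∧ MeasureTheory.volume ({z : Fin (K + M) → ℝ | (fun i : Fin K => z (Fin.castAdd M i)) ∈ b.domain ∧ ∀ j : Fin M, z (Fin.natAdd K j) ∈ Set.Icc (0:ℝ) 1} \ s'.domain) = 0 ∧ (∀ z ∈ s.domain, s.integrand z = 1) ∧ (∀ z ∈ s'.domain, s'.integrand z = 1) ∧ Literature.NumberTheory.Transcendental.KZ.of s - Literature.NumberTheory.Transcendental.KZ.of s' ∈ Literature.NumberTheory.Transcendental.KZ.changeOfVariablesRel) : ∃ (M : ℕ) (s s' : Literature.NumberTheory.Transcendental.KZ.IntegralRep (K + M)), s.domain ⊆ {z | (fun i : Fin K => z (Fin.castAdd M i)) ∈ a.domain ∧ ∀ j : Fin M, z (Fin.natAdd K j) ∈ Set.Icc (0:ℝ) 1} ∧ MeasureTheory.volume ({z : Fin (K + M) → ℝ | (fun i : Fin K => z (Fin.castAdd M i)) ∈ a.domain ∧ ∀ j : Fin M, z (Fin.natAdd K j) ∈ Set.Icc (0:ℝ) 1} \ s.domain) = 0 ∧ s'.domain ⊆ {z | (fun i : Fin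 K => z (Fin.castAdd M i)) ∈ b.domain ∧ ∀ j : Fin M, z (Fin.natAdd K j) ∈ Set.Icc (0:ℝ) 1} ∧ (∀ z ∈ s.domain, s.integrand z = 1) ∧ (∀ z ∈ s'.domain, s'.integrand z = 1) ∧ Literature.NumberTheory.Transcendental.KZ.of s - Literature.NumberTheory.Transcendental.KZ.of s' ∈ Literature.NumberTheory.Transcendental.KZ.changeOfVariablesRel := by
  obtain ⟨M, s, s', hs, hsn, hs', -, hs1, hs'1, hcov⟩ := h
  exact ⟨M, s, s', hs, hsn, hs', hs1, hs'1, hcov⟩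

/-! ### The assembly -/

/-- **The split, glued.** `StableBounding → BoundedExhaustion → EmbeddingTransitive →
StableArchimedes → StableSetTransport`: given integrand-`1` representations `r, r'` of one
dimension with equal value, feed STABLE ARCHIMEDES; its hypothesis asks, for every slack set `e`
of non-empty interior one dimension up, for a stable embedding of `r × [0,1]²` into
`(r' × [0,1]²) ⊔ (e × [2,3])` (and symmetrically). Values: `vol(r × [0,1]²) = vol r = vol r' <
vol r' + vol e` (slabs are Newton–Leibniz moves, gluing is domain additivity, `vol e > 0` by the
interior); STABLE BOUNDING replaces both ends by bounded sets of the same values (soundness of the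
transport, cylinder reduction), BOUNDED EXHAUSTION embeds the smaller into the larger, and the
embeddings compose (EMBEDDING TRANSITIVE) through the forgotten-fullness ends of the boundings. -/
theorem StableSetTransport_of_subs :
    (∀ ⦃N : ℕ⦄ (r : Literature.NumberTheory.Transcendental.KZ.IntegralRep N), (∀ x ∈ r.domain, r.integrand x = 1) → ∃ b : Literature.NumberTheory.Transcendental.KZ.IntegralRep N, Bornology.IsBounded b.domain ∧ (∀ x ∈ b.domain, b.integrand x = 1) ∧ (∃ (M : ℕ) (s s' : Literature.NumberTheory.Transcendental.KZ.IntegralRep (N + M)), s.domain ⊆ {z | (fun i : Fin N => z (Fin.castAdd M i)) ∈ r.domain ∧ ∀ j : Fin M, z (Fin.natAdd N j) ∈ Set.Icc (0:ℝ) 1} ∧ MeasureTheory.volume ({z : Fin (N + M) → ℝ | (fun i : Fin N => z (Fin.castAdd M i)) ∈ r.domain ∧ ∀ j : Fin M, z (Fin.natAdd N j) ∈ Set.Icc (0:ℝ) 1} \ s.domain) = 0 ∧ s'.domain ⊆ {z | (fun i : Fin N => z (Fin.castAdd M i)) ∈ b.domain ∧ ∀ j : Fin M, z (Fin.natAdd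 N j) ∈ Set.Icc (0:ℝ) 1} ∧ MeasureTheory.volume ({z : Fin (N + M) → ℝ | (fun i : Fin N => z (Fin.castAdd M i)) ∈ b.domain ∧ ∀ j : Fin M, z (Fin.natAdd N j) ∈ Set.Icc (0:ℝ) 1} \ s'.domain) = 0 ∧ (∀ z ∈ s.domain, s.integrand z = 1) ∧ (∀ z ∈ s'.domain, s'.integrand z = 1) ∧ Literature.NumberTheory.Transcendental.KZ.of s - Literature.NumberTheory.Transcendental.KZ.of s' ∈ Literature.NumberTheory.Transcendental.KZ.changeOfVariablesRel) ∧ (∃ (M : ℕ) (s s' : Literature.NumberTheory.Transcendental.KZ.IntegralRep (N + M)), s.domain ⊆ {z | (fun i : Fin N => z (Fin.castAdd M i)) ∈ b.domain ∧ ∀ j : Fin M, z (Fin.natAdd N j) ∈ Set.Icc (0:ℝ) 1} ∧ MeasureTheory.volume ({z : Fin (N + M) → ℝ | (fun i : Fin N => z (Fin.castAdd M i)) ∈ b.domain ∧ ∀ j : Fin M, z (Fin.natAdd N j) ∈ Set.Icc (0:ℝ) 1} \ s.domain) = 0 ∧ s'.domain ⊆ {z | (fun i : Fin N => z (Fin.castAdd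 M i)) ∈ r.domain ∧ ∀ j : Fin M, z (Fin.natAdd N j) ∈ Set.Icc (0:ℝ) 1} ∧ MeasureTheory.volume ({z : Fin (N + M) → ℝ | (fun i : Fin N => z (Fin.castAdd M i)) ∈ r.domain ∧ ∀ j : Fin M, z (Fin.natAdd N j) ∈ Set.Icc (0:ℝ) 1} \ s'.domain) = 0 ∧ (∀ z ∈ s.domain, s.integrand z = 1) ∧ (∀ z ∈ s'.domain, s'.integrand z = 1) ∧ Literature.NumberTheory.Transcendental.KZ.of s - Literature.NumberTheory.Transcendental.KZ.of s' ∈ Literature.NumberTheory.Transcendental.KZ.changeOfVariablesRel)) →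
    (∀ ⦃N : ℕ⦄ (r r' : Literature.NumberTheory.Transcendental.KZ.IntegralRep N), Bornology.IsBounded r.domain → Bornology.IsBounded r'.domain → (∀ x ∈ r.domain, r.integrand x = 1) → (∀ x ∈ r'.domain, r'.integrand x = 1) → r.value < r'.value → ∃ (M : ℕ) (s s' : Literature.NumberTheory.Transcendental.KZ.IntegralRep (N + M)), s.domain ⊆ {z | (fun i : Fin N => z (Fin.castAdd M i)) ∈ r.domain ∧ ∀ j : Fin M, z (Fin.natAdd N j) ∈ Set.Icc (0:ℝ) 1} ∧ MeasureTheory.volume ({z : Fin (N + M) → ℝ | (fun i : Fin N => z (Fin.castAdd M i)) ∈ r.domain ∧ ∀ j : Fin M, z (Fin.natAdd N j) ∈ Set.Icc (0:ℝ) 1} \ s.domain) = 0 ∧ s'.domain ⊆ {z | (fun i : Fin N => z (Fin.castAdd M i)) ∈ r'.domain ∧ ∀ j : Fin M, z (Fin.natAdd N j) ∈ Set.Icc (0:ℝ) 1} ∧ (∀ z ∈ s.domain, s.integrand z = 1) ∧ (∀ z ∈ s'.domain, s'.integrand z = 1) ∧ Literature.NumberTheory.Transcendental.KZ.of s - Literature.NumberTheory.Transcendental.KZ.of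 s' ∈ Literature.NumberTheory.Transcendental.KZ.changeOfVariablesRel) →
    (∀ ⦃N : ℕ⦄ (a b c : Literature.NumberTheory.Transcendental.KZ.IntegralRep N), (∀ x ∈ a.domain, a.integrand x = 1) → (∀ x ∈ b.domain, b.integrand x = 1) → (∀ x ∈ c.domain, c.integrand x = 1) → (∃ (M : ℕ) (s s' : Literature.NumberTheory.Transcendental.KZ.IntegralRep (N + M)), s.domain ⊆ {z | (fun i : Fin N => z (Fin.castAdd M i)) ∈ a.domain ∧ ∀ j : Fin M, z (Fin.natAdd N j) ∈ Set.Icc (0:ℝ) 1} ∧ MeasureTheory.volume ({z : Fin (N + M) → ℝ | (fun i : Fin N => z (Fin.castAdd M i)) ∈ a.domain ∧ ∀ j : Fin M, z (Fin.natAdd N j) ∈ Set.Icc (0:ℝ) 1} \ s.domain) = 0 ∧ s'.domain ⊆ {z | (fun i : Fin N => z (Fin.castAdd M i)) ∈ b.domain ∧ ∀ j : Fin M, z (Fin.natAdd N j) ∈ Set.Icc (0:ℝ) 1} ∧ (∀ z ∈ s.domain, s.integrand z = 1) ∧ (∀ z ∈ s'.domain, s'.integrand z = 1) ∧ Literature.NumberTheory.Transcendental.KZ.of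 s - Literature.NumberTheory.Transcendental.KZ.of s' ∈ Literature.NumberTheory.Transcendental.KZ.changeOfVariablesRel) → (∃ (M : ℕ) (s s' : Literature.NumberTheory.Transcendental.KZ.IntegralRep (N + M)), s.domain ⊆ {z | (fun i : Fin N => z (Fin.castAdd M i)) ∈ b.domain ∧ ∀ j : Fin M, z (Fin.natAdd N j) ∈ Set.Icc (0:ℝ) 1} ∧ MeasureTheory.volume ({z : Fin (N + M) → ℝ | (fun i : Fin N => z (Fin.castAdd M i)) ∈ b.domain ∧ ∀ j : Fin M, z (Fin.natAdd N j) ∈ Set.Icc (0:ℝ) 1} \ s.domain) = 0 ∧ s'.domain ⊆ {z | (fun i : Fin N => z (Fin.castAdd M i)) ∈ c.domain ∧ ∀ j : Fin M, z (Fin.natAdd N j) ∈ Set.Icc (0:ℝ) 1} ∧ (∀ z ∈ s.domain, s.integrand z = 1) ∧ (∀ z ∈ s'.domain, s'.integrand z = 1) ∧ Literature.NumberTheory.Transcendental.KZ.of s - Literature.NumberTheory.Transcendental.KZ.of s' ∈ Literature.NumberTheory.Transcendental.KZ.changeOfVariablesRel) → ∃ (M : ℕ) (s s' : Literature.NumberTheory.Transcendental.KZ.IntegralRep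 (N + M)), s.domain ⊆ {z | (fun i : Fin N => z (Fin.castAdd M i)) ∈ a.domain ∧ ∀ j : Fin M, z (Fin.natAdd N j) ∈ Set.Icc (0:ℝ) 1} ∧ MeasureTheory.volume ({z : Fin (N + M) → ℝ | (fun i : Fin N => z (Fin.castAdd M i)) ∈ a.domain ∧ ∀ j : Fin M, z (Fin.natAdd N j) ∈ Set.Icc (0:ℝ) 1} \ s.domain) = 0 ∧ s'.domain ⊆ {z | (fun i : Fin N => z (Fin.castAdd M i)) ∈ c.domain ∧ ∀ j : Fin M, z (Fin.natAdd N j) ∈ Set.Icc (0:ℝ) 1} ∧ (∀ z ∈ s.domain, s.integrand z = 1) ∧ (∀ z ∈ s'.domain, s'.integrand z = 1) ∧ Literature.NumberTheory.Transcendental.KZ.of s - Literature.NumberTheory.Transcendental.KZ.of s' ∈ Literature.NumberTheory.Transcendental.KZ.changeOfVariablesRel) →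
    (∀ ⦃N : ℕ⦄ (r r' : Literature.NumberTheory.Transcendental.KZ.IntegralRep N), (∀ x ∈ r.domain, r.integrand x = 1) → (∀ x ∈ r'.domain, r'.integrand x = 1) → (∀ e : Literature.NumberTheory.Transcendental.KZ.IntegralRep (N + 1), (∀ x ∈ e.domain, e.integrand x = 1) → (interior e.domain).Nonempty → (∃ (M : ℕ) (s s' : Literature.NumberTheory.Transcendental.KZ.IntegralRep ((N + 1 + 1) + M)), s.domain ⊆ {z | (fun i : Fin (N + 1 + 1) => z (Fin.castAdd M i)) ∈ ((r.slab 0).slab 0).domain ∧ ∀ j : Fin M, z (Fin.natAdd (N + 1 + 1) j) ∈ Set.Icc (0:ℝ) 1} ∧ MeasureTheory.volume ({z : Fin ((N + 1 + 1) + M) → ℝ | (fun i : Fin (N + 1 + 1) => z (Fin.castAdd M i)) ∈ ((r.slab 0).slab 0).domain ∧ ∀ j : Fin M, z (Fin.natAdd (N + 1 + 1) j) ∈ Set.Icc (0:ℝ) 1} \ s.domain) = 0 ∧ s'.domain ⊆ {z | (fun i : Fin (N + 1 + 1) => z (Fin.castAdd M i)) ∈ (((r'.slab 0).slab 0).glue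 (e.slab 2) (Literature.NumberTheory.Transcendental.KZ.IntegralRep.disjoint_domain_slab_zero_two (r'.slab 0) e)).domain ∧ ∀ j : Fin M, z (Fin.natAdd (N + 1 + 1) j) ∈ Set.Icc (0:ℝ) 1} ∧ (∀ z ∈ s.domain, s.integrand z = 1) ∧ (∀ z ∈ s'.domain, s'.integrand z = 1) ∧ Literature.NumberTheory.Transcendental.KZ.of s - Literature.NumberTheory.Transcendental.KZ.of s' ∈ Literature.NumberTheory.Transcendental.KZ.changeOfVariablesRel) ∧ (∃ (M : ℕ) (s s' : Literature.NumberTheory.Transcendental.KZ.IntegralRep ((N + 1 + 1) + M)), s.domain ⊆ {z | (fun i : Fin (N + 1 + 1) => z (Fin.castAdd M i)) ∈ ((r'.slab 0).slab 0).domain ∧ ∀ j : Fin M, z (Fin.natAdd (N + 1 + 1) j) ∈ Set.Icc (0:ℝ) 1} ∧ MeasureTheory.volume ({z : Fin ((N + 1 + 1) + M) → ℝ | (fun i : Fin (N + 1 + 1) => z (Fin.castAdd M i)) ∈ ((r'.slab 0).slab 0).domain ∧ ∀ j : Fin M, z (Fin.natAdd (N + 1 + 1) j) ∈ Set.Icc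 (0:ℝ) 1} \ s.domain) = 0 ∧ s'.domain ⊆ {z | (fun i : Fin (N + 1 + 1) => z (Fin.castAdd M i)) ∈ (((r.slab 0).slab 0).glue (e.slab 2) (Literature.NumberTheory.Transcendental.KZ.IntegralRep.disjoint_domain_slab_zero_two (r.slab 0) e)).domain ∧ ∀ j : Fin M, z (Fin.natAdd (N + 1 + 1) j) ∈ Set.Icc (0:ℝ) 1} ∧ (∀ z ∈ s.domain, s.integrand z = 1) ∧ (∀ z ∈ s'.domain, s'.integrand z = 1) ∧ Literature.NumberTheory.Transcendental.KZ.of s - Literature.NumberTheory.Transcendental.KZ.of s' ∈ Literature.NumberTheory.Transcendental.KZ.changeOfVariablesRel)) → ∃ (M : ℕ) (s s' : Literature.NumberTheory.Transcendental.KZ.IntegralRep (N + M)), s.domain ⊆ {z | (fun i : Fin N => z (Fin.castAdd M i)) ∈ r.domain ∧ ∀ j : Fin M, z (Fin.natAdd N j) ∈ Set.Icc (0:ℝ) 1} ∧ MeasureTheory.volume ({z : Fin (N + M) → ℝ | (fun i : Fin N => z (Fin.castAdd M i)) ∈ r.domain ∧ ∀ j : Fin M, z (Fin.natAdd N j) ∈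 Set.Icc (0:ℝ) 1} \ s.domain) = 0 ∧ s'.domain ⊆ {z | (fun i : Fin N => z (Fin.castAdd M i)) ∈ r'.domain ∧ ∀ j : Fin M, z (Fin.natAdd N j) ∈ Set.Icc (0:ℝ) 1} ∧ MeasureTheory.volume ({z : Fin (N + M) → ℝ | (fun i : Fin N => z (Fin.castAdd M i)) ∈ r'.domain ∧ ∀ j : Fin M, z (Fin.natAdd N j) ∈ Set.Icc (0:ℝ) 1} \ s'.domain) = 0 ∧ (∀ z ∈ s.domain, s.integrand z = 1) ∧ (∀ z ∈ s'.domain, s'.integrand z = 1) ∧ Literature.NumberTheory.Transcendental.KZ.of s - Literature.NumberTheory.Transcendental.KZ.of s' ∈ Literature.NumberTheory.Transcendental.KZ.changeOfVariablesRel) →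
    Summit.KontsevichZagierPeriods.KontsevichZagierPeriods.Theses.ScissorsTransport.StableSetTransport := by
  intro hB hE hT hA
  unfold Summit.KontsevichZagierPeriods.KontsevichZagierPeriods.Theses.ScissorsTransport.StableSetTransport
  intro N r r' h1 h1' hv
  refine hA r r' h1 h1' ?_
  intro e he hei
  -- the generic step in dimension N + 2: strictly smaller value ⟹ stable embedding
  have key : ∀ (a g : IntegralRep (N + 1 + 1)), (∀ x ∈ a.domain, a.integrand x = 1) →
      (∀ x ∈ g.domain, g.integrand x = 1) → a.value < g.value → ∃ (M : ℕ) (s s' : Literature.NumberTheory.Transcendental.KZ.IntegralRep ((N + 1 + 1) + M)), s.domain ⊆ {z | (fun i : Fin (N + 1 + 1) => z (Fin.castAdd M i)) ∈ a.domain ∧ ∀ j : Fin M, z (Fin.natAdd (N + 1 + 1) j) ∈ Set.Icc (0:ℝ) 1} ∧ MeasureTheory.volume ({z : Fin ((N + 1 + 1) + M) → ℝ | (fun i : Fin (N + 1 + 1) => z (Fin.castAdd M i)) ∈ a.domain ∧ ∀ j : Fin M, z (Fin.natAdd (N + 1 + 1) j) ∈ Set.Icc (0:ℝ) 1} \ s.domain)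 = 0 ∧ s'.domain ⊆ {z | (fun i : Fin (N + 1 + 1) => z (Fin.castAdd M i)) ∈ g.domain ∧ ∀ j : Fin M, z (Fin.natAdd (N + 1 + 1) j) ∈ Set.Icc (0:ℝ) 1} ∧ (∀ z ∈ s.domain, s.integrand z = 1) ∧ (∀ z ∈ s'.domain, s'.integrand z = 1) ∧ Literature.NumberTheory.Transcendental.KZ.of s - Literature.NumberTheory.Transcendental.KZ.of s' ∈ Literature.NumberTheory.Transcendental.KZ.changeOfVariablesRel := by
    intro a g ha hg hlt
    obtain ⟨b, hbB, hb1, hab, hba⟩ := hB a ha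
    obtain ⟨c, hcB, hc1, hgc, hcg⟩ := hB g hg
    have hvab : a.value = b.value := value_eq_of_transport' a b ha hb1 hab
    have hvgc : g.value = c.value := value_eq_of_transport' g c hg hc1 hgc
    have hbc : b.value < c.value := by rw [← hvab, ← hvgc]; exact hlt
    have e_bc := hE b c hbB hcB hb1 hc1 hbc
    have e_ab := embedding_of_transport' a b hab
    have e_cg := embedding_of_transport' c g hcg
    exact hT a c g ha hc1 hg (hT a b c ha hb1 hc1 e_ab e_bc) e_cg
  have hr2 : ∀ x ∈ ((r.slab 0).slab 0).domain, ((r.slab 0).slab 0).integrand x = 1 :=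
    slab_integrand_eq_one' _ 0 (slab_integrand_eq_one' r 0 h1)
  have hr2' : ∀ x ∈ ((r'.slab 0).slab 0).domain, ((r'.slab 0).slab 0).integrand x = 1 :=
    slab_integrand_eq_one' _ 0 (slab_integrand_eq_one' r' 0 h1')
  have he2 : ∀ x ∈ (e.slab 2).domain, (e.slab 2).integrand x = 1 := slab_integrand_eq_one' e 2 he
  have hepos : 0 < e.value := value_pos_of_interior' e he hei
  refine ⟨key ((r.slab 0).slab 0) (((r'.slab 0).slab 0).glue (e.slab 2) (Literature.NumberTheory.Transcendental.KZ.IntegralRep.disjoint_domain_slab_zero_two (r'.slab 0) e)) hr2 (glue_integrand_eq_one' _ _ _ hr2' he2) ?_,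
    key ((r'.slab 0).slab 0) (((r.slab 0).slab 0).glue (e.slab 2) (Literature.NumberTheory.Transcendental.KZ.IntegralRep.disjoint_domain_slab_zero_two (r.slab 0) e)) hr2' (glue_integrand_eq_one' _ _ _ hr2 he2) ?_⟩
  · rw [value_glue', value_slab', value_slab', value_slab', value_slab', value_slab', ← hv]
    linarith
  · rw [value_glue', value_slab', value_slab', value_slab', value_slab', value_slab', hv]
    linarith

end Summit.KontsevichZagierPeriods.ScissorsTransport.StableSetTransportSplit
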